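import Literature.NumberTheory.DiophantineGeometry.FunctionFieldSchmidtDegreeOneConsequencesProofs
import Literature.NumberTheory.DiophantineGeometry.FunctionFieldZetaLPolynomialProofs
import HarnessLib

/-!
# `L(1) = h`: the value of the `L`-polynomial at `1` is the class number (Stichtenoth Thm. 5.1.15 (c))

Topic `NumberTheory/DiophantineGeometry` (function fields over finite fields), sibling **proof file**
(theorems only; D-0014, D-0026: no named facts) of `FunctionFieldZeta` /
`FunctionFieldZetaRationalityProofs`.

For an algebraic function field `F/𝔽_q` of one variable with full constant field `𝔽_q`, genus `g` and
class number `h = |Cl⁰(F)|`, the `L`-polynomial `L(t) = (1 - t)(1 - qt) Z(t) ∈ ℤ[t]`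
(`lSeries_eq_polynomial_holds`, Thm. 5.1.15 (a)) satisfies **`L(1) = h`** (H. Stichtenoth,
*Algebraic Function Fields and Codes*, 2nd ed., Thm. 5.1.15 (c), p. 165 of the held copy; printed
proof p. 166: "`L(t) = (1-t)(1-qt)F(t) + h/(q-1) (q^g t^{2g-1}(1-t) - (1-qt))`. Hence `L(1) = h`").

The proof here avoids the partial-fraction form of `Z(t)` (Prop. 5.1.6 / Cor. 5.1.12) and reads
`L(1)` off eq. (5.12) directly: comparing coefficients in `L(t) = (1 - (q+1)t + qt²) ∑ Aₙ tⁿ`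
(`coeff_one_lSeries`, `coeff_add_two_lSeries`) the partial sums telescope,
`∑_{m ≤ M+1} a_m = A_{M+1} - q A_M` (`sum_range_coeff_lSeries`), and for `M ≥ 2g - 1` Lemma 5.1.4 (c)
(`A_n (q-1) = h (q^{n+1-g} - 1)` for `n > 2g - 2`, `numEffDivisors_mul_sub_one_eq`, with F. K.
Schmidt's `∂ = 1`, `minPosDegree_eq_one_holds`) gives `(A_{M+1} - q A_M)(q - 1) = h (q - 1)`.

## Contents (all proved)

* `sum_range_coeff_lSeries` — `∑_{m=0}^{M+1} a_m = A_{M+1} - q A_M` (eq. (5.12), telescoped);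
* `numEffDivisors_succ_sub_mul_eq_classNumber` — `A_{M+1} - q A_M = h` for `M ≥ 2g`
  (Lemma 5.1.4 (c) at the two degrees `M`, `M + 1`);
* **`eval_one_eq_classNumber`** — Thm. 5.1.15 (c): if `(L : ℤ⟦t⟧) = L_F(t)` then `L(1) = h`;
* `exists_lPolynomial_eval_one` — pointwise form: `∃ L ∈ ℤ[t]`, `deg L = 2g`, `↑L = L_F(t)`,
  `L(1) = h`;
* `classNumber_eq_prod_one_sub_inv_roots` — with Thm. 5.1.15 (e) (`eq_prod_one_sub_inv_mul_X`):
  `h = ∏_{L(z)=0} (1 - z⁻¹)` over the complex roots of `L` counted with multiplicity, i.e.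
  `h = ∏ᵢ (1 - αᵢ)` for the reciprocal roots `αᵢ` (Rosen, proof of Prop. 5.11:
  "`h_K = L_K(1) = ∏ (1 - πᵢ)`, by Theorem 5.9"), the form in which the class number enters Weil's
  determination of the characteristic polynomial of Frobenius (Milne, *Jacobian varieties*, §11).

## References

* H. Stichtenoth, *Algebraic Function Fields and Codes*, 2nd ed., GTM 254, Springer 2009: Lemma 5.1.4,
  eq. (5.12), Thm. 5.1.15 (a), (c), (e). [Stichtenoth2009]
* M. Rosen, *Number Theory in Function Fields*, GTM 210, Springer 2002, Ch. 5, Thm. 5.9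
  (`L_K(1) = h_K`). [RosenFunctionFields2002]

## Design notes

* Everything is moved to `ℤ` (resp. `ℂ`) before any algebra; `q - 1 ≠ 0` cancels the common factor.
* Mathlib/Literature searched: `Polynomial.eval_eq_sum_range'`, `Polynomial.coeff_coe`,
  `Polynomial.eval_multiset_prod` (Mathlib, used); `coeff_one_lSeries`, `coeff_add_two_lSeries`,
  `numEffDivisors_mul_sub_one_eq`, `coeff_lSeries_eq_zero`, `minPosDegree_eq_one_holds`,
  `lSeries_eq_polynomial_holds`, `eq_prod_one_sub_inv_mul_X` (tree, used). No declaration evaluating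
  `lSeries`/an `L`-polynomial at `1` existed (`lean search 'eval 1|eval_one' ∧ lSeries`).
-/

noncomputable section

open scoped Classical

namespace Literature.NumberTheory.DiophantineGeometry.AlgFunctionField

universe u v

variable {K : Type u} {F : Type v} [Field K] [Field F] [Algebra K F]

open PowerSeries Polynomial

/-! ### Telescoping the coefficients of `(1 - t)(1 - qt) Z(t)` -/

section Telescope

variable [Fintype K] [IsAlgFunctionField K F]

/-- **Eq. (5.12) telescoped**: `∑_{m=0}^{M+1} a_m = A_{M+1} - q · A_M`, where
`L(t) = ∑ a_m t^m = (1 - (q+1) t + q t²) ∑ A_n tⁿ` (`coeff_one_lSeries`, `coeff_add_two_lSeries`).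
[cite: Stichtenoth2009, eq. (5.12)] -/
theorem sum_range_coeff_lSeries (M : ℕ) :
    ∑ m ∈ Finset.range (M + 2), PowerSeries.coeff m (lSeries K F) =
      (numEffDivisors K F (M + 1) : ℤ) - (Fintype.card K : ℤ) * numEffDivisors K F M := by
  induction M with
  | zero =>
    rw [Finset.sum_range_succ, Finset.sum_range_succ, Finset.sum_range_zero, zero_add,
      PowerSeries.coeff_zero_eq_constantCoeff, constantCoeff_lSeries, coeff_one_lSeries,
      numEffDivisors_zero]
    push_cast
    ring
  | succ M ih =>
    rw [Finset.sum_range_succ, ih, show M + 1 + 1 = M + 2 from rfl, coeff_add_two_lSeries]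
    ring

end Telescope

/-! ### Thm. 5.1.15 (c): `L(1) = h` -/

section AtOne

variable [Fintype K] [IsAlgFunctionField K F] [IsIntegrallyClosedIn K F]

/-- **Lemma 5.1.4 (c) at two consecutive degrees**: for `M ≥ 2g` (so that `M, M+1 > 2g - 2`),
`A_{M+1} - q A_M = h`: indeed `(q-1) A_{M+1} = h (q^{M+2-g} - 1)` and `(q-1) A_M = h (q^{M+1-g} - 1)`,
whence `(q-1)(A_{M+1} - q A_M) = h (q - 1)` (with F. K. Schmidt's `∂ = 1`, `minPosDegree_eq_one_holds`).
[cite: Stichtenoth2009, Lemma 5.1.4(c) and Cor. 5.1.11] -/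
theorem numEffDivisors_succ_sub_mul_eq_classNumber {M : ℕ} (hM : 2 * genus K F ≤ M) :
    (numEffDivisors K F (M + 1) : ℤ) - (Fintype.card K : ℤ) * numEffDivisors K F M =
      classNumber K F := by
  have h1 : minPosDegree K F = 1 := minPosDegree_eq_one_holds K F
  have hA := numEffDivisors_mul_sub_one_eq (K := K) (F := F) h1 (n := M) (by omega)
  have hB := numEffDivisors_mul_sub_one_eq (K := K) (F := F) h1 (n := M + 1) (by omega)
  set q : ℤ := (Fintype.card K : ℤ) with hq
  set g := genus K F with hg
  have hq1 : (1 : ℤ) < q := by rw [hq]; exact_mod_cast Fintype.one_lt_card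
  have hne : q - 1 ≠ 0 := by linarith
  have hexp : M + 1 + 1 - g = (M + 1 - g) + 1 := by omega
  rw [hexp, pow_succ] at hB
  apply mul_left_cancel₀ hne
  -- `(q-1)(A_{M+1} - q A_M) = (q-1) A_{M+1} - q (q-1) A_M = h (q^{e} q - 1) - q h (q^e - 1) = h (q-1)`
  have key : (q - 1) * ((numEffDivisors K F (M + 1) : ℤ) - q * numEffDivisors K F M) =
      (numEffDivisors K F (M + 1) : ℤ) * (q - 1) - q * ((numEffDivisors K F M : ℤ) * (q - 1)) := by
    ring
  rw [key, hA, hB]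
  ring

/-- **Stichtenoth Thm. 5.1.15 (c): `L(1) = h`.**  For an algebraic function field `F/𝔽_q` of one
variable with full constant field `𝔽_q`, every polynomial `L ∈ ℤ[t]` whose power series is the
`L`-polynomial `L_F(t) = (1 - t)(1 - qt) Z_F(t)` (it exists and is unique, Thm. 5.1.15 (a),
`lSeries_eq_polynomial_holds`) satisfies `L(1) = h`, the class number `|Cl⁰(F)|`.  Printed proof:
`L(t) = (1-t)(1-qt)F(t) + h/(q-1)·(q^g t^{2g-1}(1-t) - (1-qt))`, hence `L(1) = h`; here: `L(1)` is the
sum of the coefficients `a_0, …, a_{M+1}` for `M` large, which telescopes to `A_{M+1} - q A_M = h`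
(`sum_range_coeff_lSeries`, `numEffDivisors_succ_sub_mul_eq_classNumber`).
[cite: Stichtenoth2009, Thm. 5.1.15(c)] [cite: RosenFunctionFields2002, Thm. 5.9] -/
theorem eval_one_eq_classNumber (L : ℤ[X]) (hL : (L : PowerSeries ℤ) = lSeries K F) :
    L.eval 1 = classNumber K F := by
  set M : ℕ := max L.natDegree (2 * genus K F) with hM
  have hdeg : L.natDegree < M + 2 := by omega
  rw [Polynomial.eval_eq_sum_range' hdeg]
  simp only [one_pow, mul_one]
  have hcoeff : ∀ m, L.coeff m = PowerSeries.coeff m (lSeries K F) := fun m => by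
    rw [← hL, Polynomial.coeff_coe]
  simp only [hcoeff]
  rw [sum_range_coeff_lSeries, numEffDivisors_succ_sub_mul_eq_classNumber (le_max_right _ _)]

variable (K F) in
/-- Pointwise form of Thm. 5.1.15 (a) + (c): there is `L ∈ ℤ[t]` of degree `2g` with
`(L : ℤ⟦t⟧) = L_F(t)` and `L(1) = h`. [cite: Stichtenoth2009, Thm. 5.1.15(a),(c)] -/
theorem exists_lPolynomial_eval_one :
    ∃ L : ℤ[X], L.natDegree = 2 * genus K F ∧ (L : PowerSeries ℤ) = lSeries K F ∧
      L.eval 1 = classNumber K F := by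
  obtain ⟨L, hdeg, hL⟩ := lSeries_eq_polynomial_holds (K := K) (F := F)
  exact ⟨L, hdeg, hL, eval_one_eq_classNumber L hL⟩

/-- **`h = ∏ (1 - αᵢ)`** over the reciprocal roots of the `L`-polynomial (Thm. 5.1.15 (c) with (e)):
for `L ∈ ℤ[t]` with `(L : ℤ⟦t⟧) = L_F(t)`, over `ℂ` one has `L(t) = ∏_{L(z)=0} (1 - z⁻¹ t)`
(`eq_prod_one_sub_inv_mul_X`, the roots counted with multiplicity), hence
`h = L(1) = ∏_{L(z)=0} (1 - z⁻¹)`.  This is the identity `h_F = L_F(1) = ∏ᵢ (1 - αᵢ)` by which the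
class number enters Weil's determination of the characteristic polynomial of Frobenius
(Milne, *Jacobian varieties*, §11; Rosen, proof of Prop. 5.11: `h_K = L_K(1) = ∏ (1 - πᵢ)`).
[cite: Stichtenoth2009, Thm. 5.1.15(c),(e)] [cite: RosenFunctionFields2002, Thm. 5.9 and Prop. 5.11 (proof)] -/
theorem classNumber_eq_prod_one_sub_inv_roots (L : ℤ[X]) (hL : (L : PowerSeries ℤ) = lSeries K F) :
    (classNumber K F : ℂ) = ((L.map (Int.castRingHom ℂ)).roots.map fun z => 1 - z⁻¹).prod := by
  set Lc : ℂ[X] := L.map (Int.castRingHom ℂ) with hLc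
  have hL0 : L.coeff 0 = 1 := by
    have h := congrArg (PowerSeries.coeff 0) hL
    rwa [Polynomial.coeff_coe, PowerSeries.coeff_zero_eq_constantCoeff_apply, constantCoeff_lSeries] at h
  have hLc0 : Lc.coeff 0 = 1 := by rw [hLc, Polynomial.coeff_map, hL0, map_one]
  have hcard : Multiset.card Lc.roots = Lc.natDegree :=
    Polynomial.splits_iff_card_roots.mp (IsAlgClosed.splits Lc)
  have hprod := LPolynomial.eq_prod_one_sub_inv_mul_X Lc hcard hLc0
  have heval : Lc.eval 1 = ((Lc.roots.map fun z => 1 - z⁻¹)).prod := by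
    conv_lhs => rw [hprod]
    rw [Polynomial.eval_multiset_prod, Multiset.map_map]
    refine congrArg _ (Multiset.map_congr rfl fun z _ => ?_)
    simp
  rw [← heval, hLc, Polynomial.eval_map, Polynomial.eval₂_at_one, eval_one_eq_classNumber L hL]
  simp

end AtOne

end Literature.NumberTheory.DiophantineGeometry.AlgFunctionField

end
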